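/-
Copyright (c) 2026 the pub-hodgecm-mathlib formalisation cell (harness21).  Prover seat hodgecm-mathlib-R90-C133-p02 (g2), Track B ∕ R90-TF, h413 = `stmt-HodgeConjecture-24833`,
R90-TF section S8 «ContSpec-n½» (S8 dealer R90-CS-plan (g3) S8-R213 (a) ∕ S8-R217 (4): «(T_f) FILE A — the re-expansion over ★ p864381»; census
`R90/S8/CENSUS-hTRANS-payer.R90-C133-p02-g2.md` 8d98775fd52c510b item 2): the FINITE-ADELIC half of the invariance letter `hTRANSτ` of ★ p864333 — FILE A, THE RE-EXPANSION:
the right translate `r(ι_f g)φ` of a τ-admissible pair-section at the τ-level `U₀` splits along the (finitely many, ★ p864381) values `r` of the height cocycle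
`c_g(x) = H(x·ι_f g)∕H(x)` into clopen pieces `ψ_r := 𝟙[c_g = r]·φ(·ι_f g)`, each a continuous `K_∞`-finite pair-section at the τ-level `U₀ ∩ g U₀ g⁻¹`, and the flat
families re-expand as `flat(φ, z)(x·ι_f g) = Σ_r r^z · flat(ψ_r, z)(x)` — the `hdec` input of ★ p864395 FILE B.
-/
import Summits.HodgeConjecture.HodgeConjecture.Theorems.R90S8ResGMidAtomTransOfFlatReexpansionU3   -- ★ p864395 FILE B (brings ★ τ-DEFS `IsTauLevel`∕`tauLevel`∕`IsArchFinite`, ★ pair defs, ★ `flatSectionU`, ★ `adelicVal_finAdelicToAdelic_mem_standardMaximalCompactGL`)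
import Summits.HodgeConjecture.HodgeConjecture.Theorems.R90S8HeightCocycleFiniteValuesU3          -- ★ p864381 (K2E1-p14 (g4)): the height cocycle — finitely many values, clopen fibres, left-`B(𝔸)`-invariance
import Mathlib.Topology.Algebra.Indicator                                                       -- `IsClopen.continuous_indicator`
import HarnessLib

/-!
# S8 (R)′ road, letter `hTRANSτ` step (T_f) FILE A — `R90S8ResGMidAtomFlatReexpansionU3`: THE FLAT RE-EXPANSION OF A FINITE-ADELIC TRANSLATE ALONG THE HEIGHT COCYCLE

Track B ∕ R90-TF, crux h413 = `stmt-HodgeConjecture-24833`, route of record `HCCMUnconditional`; cell `hodgecm-mathlib`, R90-TF section S8 «ContSpec-n½ ∕ ResidualSpectrum», socket (R)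
(B ED. 7 :337) ← ★ `res_midBlock_le_residual_of_letters' (hDISC) …` ← ★ p864333 `hDISC_of_tauRecord (hW1) (hTRANSτ)` ← `hTRANSτ` = (T_f) [★ p864395 FILE B + THIS FILE A + the
exports of the pieces] + (T_∞) [ARCH-INV, L].  THEOREMS ONLY (no `def`, no `instance`, no `notation`, no named-fact hypothesis, no `sorry`; default heartbeats); lane
`--supports stmt-HodgeConjecture-24833 --as helper` (count-neutral).  CLOSES NO SOCKET.  LETTER-FREE (every input is ★).

THE MATHEMATICS ([MoeglinWaldspurger1995] I.2.2, II.1.5; [Garrett2018] §2.2; [BorelJacquet1979] §4.1).  Fix `g ∈ G(𝔸_f)` and a τ-level `U₀` (open compact `≤ G(𝒪̂)_f`).  The height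
cocycle `c_g(x) := H(x ι_f g)∕H(x)` takes finitely many values (★ `exists_finset_…_cm_three`), each fibre `S_r = {c_g = r}` is clopen (★ `isClopen_setOf_…`), and `c_g` is
left-`B(𝔸)`-invariant (★ `borelHeight_borel_mul_mul_finAdelicToAdelic_div`), right-invariant under `ι_f(U₀ ∩ gU₀g⁻¹)` (`H` is right-`K_max`-invariant, ★
`borelHeight_mul_of_mem_comap_standardMaximalCompactGL`, and `ι_f u g = ι_f g · ι_f(g⁻¹ug)`) and under `ι(K_∞)` (which commutes with `ι_f g`, ★ `commute_archToAdelic_finAdelicToAdelic`).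
Hence `ψ_r := 𝟙_{S_r} · φ(· ι_f g)` is a `(χ₁, χ₂)`-pair-section, right-`ι_f(U₀ ∩ gU₀g⁻¹)`-invariant, continuous, and `r(k)ψ_r = T_r(r(k)φ)` for the linear cut-off-and-substitute map
`T_r`, so `span{r(k)ψ_r} ≤ T_r(span{r(k)φ})` is finite-dimensional; finally on `S_{c_g(x)}` one has `H(x ι_f g)^z = c_g(x)^z H(x)^z`, which is the re-expansion.
* §1 `mem_inf_comap_conj_iff`, **`isTauLevel_inf_comap_conj`** (`U₀ ∩ gU₀g⁻¹` is a τ-level: open, closed-in-compact, `≤ G(𝒪̂)_f`).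
* §2 `borelHeight_mul_finAdelicToAdelic_of_mem_integralLevel`, `finAdelicToAdelic_mul_eq_mul_conj`, `heightCocycle_mul_finAdelicToAdelic_eq`, `apply_mul_finAdelicToAdelic_mul_eq_of_mem`,
  **`indicator_translate_mem_chiSectionSpacePair`** (`ψ_r ∈ V(χ₁, χ₂; ι_f(U₀ ∩ gU₀g⁻¹), 1)`), **`continuous_indicator_translate`**, **`isArchFinite_indicator_translate`**.
* §3 **`flatSectionU_mul_finAdelicToAdelic_eq_sum`** (`flat(φ,z)(x ι_f g) = Σ_{r ∈ s} r^z flat(ψ_r,z)(x)` for any finset `s ⊇ range c_g`), `exists_finset_range_heightCocycle` (`s` = the exact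
  range, all of whose members are POSITIVE — FILE B's `hc`).
HONEST LABEL: HC_CM is proved only modulo the 7 printed citations (2 remaining named inputs: hLiu418 = `stmt-HodgeConjecture-24832`, h413 = `stmt-HodgeConjecture-24833`) until
rung 0 closes; REL ≠ ★ ≠ BUILT; (T_f) = ★ FILE B ∘ THIS ★-able FILE A ∘ {the exports of the pieces (ESTATE T)}; (T_∞) L; pays no socket; count-neutral.

## References
* [MoeglinWaldspurger1995] C. Mœglin, J.-L. Waldspurger, *Spectral Decomposition and Eisenstein Series* (1995), I.2.2, I.2.17, II.1.5.
* [Garrett2018] P. Garrett, *Modern Analysis of Automorphic Forms by Example*, vol. 1 (2018), §2.2.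
* [BorelJacquet1979] A. Borel, H. Jacquet, *Automorphic forms and automorphic representations*, Proc. Symp. Pure Math. 33.1 (1979), §1.3, §4.1.
-/

set_option autoImplicit false
set_option linter.dupNamespace false  -- the mandated namespace `…HodgeConjecture.HodgeConjecture.R90.S8` (LEAD #1 L1) repeats the summit's segment

noncomputable section

open MeasureTheory Measure Set Filter Topology NumberField ContRepresentation
open Literature.NumberTheory Literature.NumberTheory.Automorphic Literature.NumberTheory.Automorphic.UnitaryGroup Literature.NumberTheory.GaloisRepresentations AdelicGroupData
open Literature.NumberTheory.Automorphic.Arthur2013.Leaves.TECR Literature.NumberTheory.Rogawski1990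
open Summit.HodgeConjecture.HodgeConjecture.Cruxes.H413.K2E1BorelEisensteinU
open Summit.HodgeConjecture.HodgeConjecture.Cruxes.H413.K2E1CharacterEisensteinU2Defs (firstEntryUnit)
open Summit.HodgeConjecture.HodgeConjecture.Cruxes.H413.K2E1CharacterEisensteinU3PairDefs
open Summit.HodgeConjecture.HodgeConjecture.Cruxes.H413.K2E1ChiSectionSpaceU3PairDefs
open scoped ENNReal NNReal

namespace Summit.HodgeConjecture.HodgeConjecture.R90.S8

variable (L : Type) [Field L] [NumberField L] [IsCMField L]

/-! ## §1 The conjugated τ-level `U₀ ∩ g U₀ g⁻¹` -/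

/-- Membership in `U₀ ⊓ U₀.comap (Ad g⁻¹)`: `u ∈ U₀` and `g⁻¹ u g ∈ U₀` (i.e. `u ∈ U₀ ∩ g U₀ g⁻¹`). [cite: BorelJacquet1979, §4.1] -/
theorem mem_inf_comap_conj_iff (U₀ : Subgroup ↥(finAdelic (↥(maximalRealSubfield L)) L (IsCMField.complexConj L) 3 ((StdForm.antidiagonal 3).over L))) (g u : ↥(finAdelic (↥(maximalRealSubfield L)) L (IsCMField.complexConj L) 3 ((StdForm.antidiagonal 3).over L))) :
    u ∈ (U₀ ⊓ U₀.comap ((MulAut.conj g).symm.toMonoidHom : ↥(finAdelic (↥(maximalRealSubfield L)) L (IsCMField.complexConj L) 3 ((StdForm.antidiagonal 3).over L)) →* ↥(finAdelic (↥(maximalRealSubfield L)) L (IsCMField.complexConj L) 3 ((StdForm.antidiagonal 3).over L)))) ↔ u ∈ U₀ ∧ g⁻¹ * u * g ∈ U₀ := by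
  rw [Subgroup.mem_inf, Subgroup.mem_comap, MulEquiv.coe_toMonoidHom, MulAut.conj_symm_apply]

variable {L} in
/-- **`U₀ ∩ g U₀ g⁻¹` IS A τ-LEVEL** when `U₀` is: it is open (conjugation is continuous), closed (an open subgroup is closed) inside the compact `U₀`, hence compact, and `≤ U₀ ≤ G(𝒪̂)_f`.
[cite: BorelJacquet1979, §4.1] [cite: MoeglinWaldspurger1995, I.2.17] -/
theorem isTauLevel_inf_comap_conj {U₀ : Subgroup ↥(finAdelic (↥(maximalRealSubfield L)) L (IsCMField.complexConj L) 3 ((StdForm.antidiagonal 3).over L))} (hU₀ : IsTauLevel L U₀) (g : ↥(finAdelic (↥(maximalRealSubfield L)) L (IsCMField.complexConj L) 3 ((StdForm.antidiagonal 3).over L))) :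
    IsTauLevel L (U₀ ⊓ U₀.comap ((MulAut.conj g).symm.toMonoidHom : ↥(finAdelic (↥(maximalRealSubfield L)) L (IsCMField.complexConj L) 3 ((StdForm.antidiagonal 3).over L)) →* ↥(finAdelic (↥(maximalRealSubfield L)) L (IsCMField.complexConj L) 3 ((StdForm.antidiagonal 3).over L)))) := by
  have hcont : Continuous fun x : ↥(finAdelic (↥(maximalRealSubfield L)) L (IsCMField.complexConj L) 3 ((StdForm.antidiagonal 3).over L)) => ((MulAut.conj g).symm.toMonoidHom : ↥(finAdelic (↥(maximalRealSubfield L)) L (IsCMField.complexConj L) 3 ((StdForm.antidiagonal 3).over L)) →* ↥(finAdelic (↥(maximalRealSubfield L)) L (IsCMField.complexConj L) 3 ((StdForm.antidiagonal 3).over L))) x := by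
    simp only [MulEquiv.coe_toMonoidHom, MulAut.conj_symm_apply]
    exact (continuous_const.mul continuous_id).mul continuous_const
  have hopen : IsOpen (((U₀ ⊓ U₀.comap ((MulAut.conj g).symm.toMonoidHom : ↥(finAdelic (↥(maximalRealSubfield L)) L (IsCMField.complexConj L) 3 ((StdForm.antidiagonal 3).over L)) →* ↥(finAdelic (↥(maximalRealSubfield L)) L (IsCMField.complexConj L) 3 ((StdForm.antidiagonal 3).over L)))) : Subgroup ↥(finAdelic (↥(maximalRealSubfield L)) L (IsCMField.complexConj L) 3 ((StdForm.antidiagonal 3).over L))) : Set ↥(finAdelic (↥(maximalRealSubfield L)) L (IsCMField.complexConj L) 3 ((StdForm.antidiagonal 3).over L))) := by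
    rw [Subgroup.coe_inf, Subgroup.coe_comap]
    exact hU₀.1.inter (hU₀.1.preimage hcont)
  refine ⟨hopen, hU₀.2.1.of_isClosed_subset (Subgroup.isClosed_of_isOpen _ hopen) ?_, inf_le_left.trans hU₀.2.2⟩
  rw [Subgroup.coe_inf]
  exact Set.inter_subset_left

/-! ## §2 The pieces `ψ_r = 𝟙[c_g = r] · φ(· ι_f g)`: pair-sections at the level `ι_f(U₀ ∩ gU₀g⁻¹)`, continuous, `K_∞`-finite -/

variable {L} in
/-- `H(x · ι_f u) = H(x)` for `u ∈ G(𝒪̂)_f` (`ι_f u ∈ K_max`, ★ `adelicVal_finAdelicToAdelic_mem_standardMaximalCompactGL`; `H` is right-`K_max`-invariant, ★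
`borelHeight_mul_of_mem_comap_standardMaximalCompactGL`). [cite: MoeglinWaldspurger1995, I.2.2] -/
theorem borelHeight_mul_finAdelicToAdelic_of_mem_integralLevel {u : ↥(finAdelic (↥(maximalRealSubfield L)) L (IsCMField.complexConj L) 3 ((StdForm.antidiagonal 3).over L))} (hu : u ∈ finAdelicIntegralLevel (↥(maximalRealSubfield L)) L (IsCMField.complexConj L) 3 ((StdForm.antidiagonal 3).over L)) (x : (quasiSplit (↥(maximalRealSubfield L)) L (IsCMField.complexConj L) 3).Adelic) :
    borelHeight (x * finAdelicToAdelic (↥(maximalRealSubfield L)) L (IsCMField.complexConj L) 3 ((StdForm.antidiagonal 3).over L) u) = borelHeight x :=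
  borelHeight_mul_of_mem_comap_standardMaximalCompactGL (Subgroup.mem_comap.2 (adelicVal_finAdelicToAdelic_mem_standardMaximalCompactGL L hu)) x

/-- `x · ι_f u · ι_f g = x · ι_f g · ι_f(g⁻¹ u g)`. [cite: BorelJacquet1979, §4.1] -/
theorem mul_finAdelicToAdelic_mul_eq_mul_conj (g u : ↥(finAdelic (↥(maximalRealSubfield L)) L (IsCMField.complexConj L) 3 ((StdForm.antidiagonal 3).over L))) (x : (quasiSplit (↥(maximalRealSubfield L)) L (IsCMField.complexConj L) 3).Adelic) :
    x * finAdelicToAdelic (↥(maximalRealSubfield L)) L (IsCMField.complexConj L) 3 ((StdForm.antidiagonal 3).over L) u * finAdelicToAdelic (↥(maximalRealSubfield L)) L (IsCMField.complexConj L) 3 ((StdForm.antidiagonal 3).over L) g = x * finAdelicToAdelic (↥(maximalRealSubfield L)) L (IsCMField.complexConj L) 3 ((StdForm.antidiagonal 3).over L) g * finAdelicToAdelic (↥(maximalRealSubfield L)) L (IsCMField.complexConj L) 3 ((StdForm.antidiagonal 3).over L) (g⁻¹ * u * g) := by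
  have hg : g * (g⁻¹ * u * g) = u * g := by rw [mul_assoc, mul_inv_cancel_left]
  rw [mul_assoc, mul_assoc, ← map_mul, ← map_mul, hg]

variable {L} in
/-- **THE HEIGHT COCYCLE IS RIGHT-`ι_f(U₀ ∩ gU₀g⁻¹)`-INVARIANT**: `c_g(x ι_f u) = c_g(x)` for `u ∈ U₀`, `g⁻¹ug ∈ U₀` (`U₀ ≤ G(𝒪̂)_f`). [cite: MoeglinWaldspurger1995, I.2.2] [cite: Garrett2018, §2.2] -/
theorem heightCocycle_mul_finAdelicToAdelic_eq {U₀ : Subgroup ↥(finAdelic (↥(maximalRealSubfield L)) L (IsCMField.complexConj L) 3 ((StdForm.antidiagonal 3).over L))} (hU₀ : IsTauLevel L U₀) (g : ↥(finAdelic (↥(maximalRealSubfield L)) L (IsCMField.complexConj L) 3 ((StdForm.antidiagonal 3).over L))) {u : ↥(finAdelic (↥(maximalRealSubfield L)) L (IsCMField.complexConj L) 3 ((StdForm.antidiagonal 3).over L))} (hu : u ∈ U₀) (hu' : g⁻¹ * u * g ∈ U₀) (x : (quasiSplit (↥(maximalRealSubfield L)) L (IsCMField.complexConj L) 3).Adelic)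 :
    borelHeight (x * finAdelicToAdelic (↥(maximalRealSubfield L)) L (IsCMField.complexConj L) 3 ((StdForm.antidiagonal 3).over L) u * finAdelicToAdelic (↥(maximalRealSubfield L)) L (IsCMField.complexConj L) 3 ((StdForm.antidiagonal 3).over L) g) / borelHeight (x * finAdelicToAdelic (↥(maximalRealSubfield L)) L (IsCMField.complexConj L) 3 ((StdForm.antidiagonal 3).over L) u) = borelHeight (x * finAdelicToAdelic (↥(maximalRealSubfield L)) L (IsCMField.complexConj L) 3 ((StdForm.antidiagonal 3).over L) g) / borelHeight x := by
  rw [mul_finAdelicToAdelic_mul_eq_mul_conj L g u x, borelHeight_mul_finAdelicToAdelic_of_mem_integralLevel (hU₀.2.2 hu'),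
    borelHeight_mul_finAdelicToAdelic_of_mem_integralLevel (hU₀.2.2 hu)]

variable {L} in
/-- **A section of level `ι_f(U₀)` satisfies `φ(x ι_f u ι_f g) = φ(x ι_f g)`** whenever `g⁻¹ u g ∈ U₀`. [cite: MoeglinWaldspurger1995, I.2.17] -/
theorem apply_mul_finAdelicToAdelic_mul_eq_of_mem {χ₁ : HeckeCharacter L} {χ₂ : ↥(TorusDict.torus (IsCMField.complexConj L)) →ₜ* ℂˣ} {U₀ : Subgroup ↥(finAdelic (↥(maximalRealSubfield L)) L (IsCMField.complexConj L) 3 ((StdForm.antidiagonal 3).over L))} (g : ↥(finAdelic (↥(maximalRealSubfield L)) L (IsCMField.complexConj L) 3 ((StdForm.antidiagonal 3).over L))) {u : ↥(finAdelic (↥(maximalRealSubfield L)) L (IsCMField.complexConj L) 3 ((StdForm.antidiagonal 3).over L))} (hu' : g⁻¹ * u * g ∈ U₀)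
    {φ : (quasiSplit (↥(maximalRealSubfield L)) L (IsCMField.complexConj L) 3).Adelic → ℂ} (hφ : φ ∈ chiSectionSpacePair χ₁ χ₂ (tauLevel L U₀) ((1 : ↥(tauLevel L U₀) →* ℂ) : ↥(tauLevel L U₀) → ℂ)) (x : (quasiSplit (↥(maximalRealSubfield L)) L (IsCMField.complexConj L) 3).Adelic) :
    φ (x * finAdelicToAdelic (↥(maximalRealSubfield L)) L (IsCMField.complexConj L) 3 ((StdForm.antidiagonal 3).over L) u * finAdelicToAdelic (↥(maximalRealSubfield L)) L (IsCMField.complexConj L) 3 ((StdForm.antidiagonal 3).over L) g) = φ (x * finAdelicToAdelic (↥(maximalRealSubfield L)) L (IsCMField.complexConj L) 3 ((StdForm.antidiagonal 3).over L) g) := by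
  rw [mul_finAdelicToAdelic_mul_eq_mul_conj L g u x]
  exact (apply_mul_of_mem hφ (x * finAdelicToAdelic (↥(maximalRealSubfield L)) L (IsCMField.complexConj L) 3 ((StdForm.antidiagonal 3).over L) g) ⟨finAdelicToAdelic (↥(maximalRealSubfield L)) L (IsCMField.complexConj L) 3 ((StdForm.antidiagonal 3).over L) (g⁻¹ * u * g), finAdelicToAdelic_mem_tauLevel L hu'⟩).trans (by rw [MonoidHom.one_apply, one_mul])

variable {L} in
/-- **THE PIECE `ψ_r = 𝟙[c_g = r]·φ(· ι_f g)` IS A `(χ₁, χ₂)`-PAIR-SECTION OF LEVEL `ι_f(U₀ ∩ gU₀g⁻¹)`** for `φ ∈ V(χ₁, χ₂; ι_f(U₀), 1)`: left `B(𝔸)`-equivariance from `φ`'s and the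
left-`B(𝔸)`-invariance of `c_g` (★ `borelHeight_borel_mul_mul_finAdelicToAdelic_div`); right invariance from the two previous lemmas. [cite: MoeglinWaldspurger1995, I.2.17, II.1.5] -/
theorem indicator_translate_mem_chiSectionSpacePair {χ₁ : HeckeCharacter L} {χ₂ : ↥(TorusDict.torus (IsCMField.complexConj L)) →ₜ* ℂˣ} {U₀ : Subgroup ↥(finAdelic (↥(maximalRealSubfield L)) L (IsCMField.complexConj L) 3 ((StdForm.antidiagonal 3).over L))} (hU₀ : IsTauLevel L U₀) (g : ↥(finAdelic (↥(maximalRealSubfield L)) L (IsCMField.complexConj L) 3 ((StdForm.antidiagonal 3).over L))) (r : ℝ≥0)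
    {φ : (quasiSplit (↥(maximalRealSubfield L)) L (IsCMField.complexConj L) 3).Adelic → ℂ} (hφ : φ ∈ chiSectionSpacePair χ₁ χ₂ (tauLevel L U₀) ((1 : ↥(tauLevel L U₀) →* ℂ) : ↥(tauLevel L U₀) → ℂ)) :
    ({x : (quasiSplit (↥(maximalRealSubfield L)) L (IsCMField.complexConj L) 3).Adelic | borelHeight (x * finAdelicToAdelic (↥(maximalRealSubfield L)) L (IsCMField.complexConj L) 3 ((StdForm.antidiagonal 3).over L) g) / borelHeight x = r}.indicator fun y => φ (y * finAdelicToAdelic (↥(maximalRealSubfield L)) L (IsCMField.complexConj L) 3 ((StdForm.antidiagonal 3).over L) g)) ∈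
      chiSectionSpacePair χ₁ χ₂ (tauLevel L (U₀ ⊓ U₀.comap ((MulAut.conj g).symm.toMonoidHom : ↥(finAdelic (↥(maximalRealSubfield L)) L (IsCMField.complexConj L) 3 ((StdForm.antidiagonal 3).over L)) →* ↥(finAdelic (↥(maximalRealSubfield L)) L (IsCMField.complexConj L) 3 ((StdForm.antidiagonal 3).over L))))) ((1 : ↥(tauLevel L (U₀ ⊓ U₀.comap ((MulAut.conj g).symm.toMonoidHom : ↥(finAdelic (↥(maximalRealSubfield L)) L (IsCMField.complexConj L) 3 ((StdForm.antidiagonal 3).over L)) →* ↥(finAdelic (↥(maximalRealSubfield L)) L (IsCMField.complexConj L) 3 ((StdForm.antidiagonal 3).over L))))) →* ℂ) : ↥(tauLevel L (U₀ ⊓ U₀.comap ((MulAut.conj g).symm.toMonoidHom : ↥(finAdelic (↥(maximalRealSubfield L)) L (IsCMField.complexConj L) 3 ((StdForm.antidiagonal 3).over L)) →* ↥(finAdelic (↥(maximalRealSubfield L)) L (IsCMField.complexConj L) 3 ((StdForm.antidiagonal 3).over L))))) → ℂ) := by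
  refine mem_chiSectionSpacePair (fun b hb x => ?_) (fun x k => ?_)
  · have hc : borelHeight (b * x * finAdelicToAdelic (↥(maximalRealSubfield L)) L (IsCMField.complexConj L) 3 ((StdForm.antidiagonal 3).over L) g) / borelHeight (b * x) = borelHeight (x * finAdelicToAdelic (↥(maximalRealSubfield L)) L (IsCMField.complexConj L) 3 ((StdForm.antidiagonal 3).over L) g) / borelHeight x :=
      borelHeight_borel_mul_mul_finAdelicToAdelic_div hb x g
    have hv : φ (b * x * finAdelicToAdelic (↥(maximalRealSubfield L)) L (IsCMField.complexConj L) 3 ((StdForm.antidiagonal 3).over L) g) = ((χ₁ (firstEntryUnit hb) : ℂˣ) : ℂ) * ((χ₂ (middleEntryUnitary hb) : ℂˣ) : ℂ) * φ (x * finAdelicToAdelic (↥(maximalRealSubfield L)) L (IsCMField.complexConj L) 3 ((StdForm.antidiagonal 3).over L) g) := by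
      rw [mul_assoc]; exact isChiSectionPair_of_mem hφ b hb (x * finAdelicToAdelic (↥(maximalRealSubfield L)) L (IsCMField.complexConj L) 3 ((StdForm.antidiagonal 3).over L) g)
    simp only [Set.indicator_apply, Set.mem_setOf_eq, hc, hv]
    split_ifs <;> simp
  · obtain ⟨u, hu, huk⟩ := (mem_tauLevel_iff L _ (k : (quasiSplit (↥(maximalRealSubfield L)) L (IsCMField.complexConj L) 3).Adelic)).1 k.2
    obtain ⟨hu0, hu1⟩ := (mem_inf_comap_conj_iff L U₀ g u).1 hu
    have hc := heightCocycle_mul_finAdelicToAdelic_eq hU₀ g hu0 hu1 x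
    have hv := apply_mul_finAdelicToAdelic_mul_eq_of_mem g hu1 hφ x
    rw [← huk]
    simp only [Set.indicator_apply, Set.mem_setOf_eq, hc, hv, MonoidHom.one_apply, one_mul]

/-- **THE PIECE `ψ_r` IS CONTINUOUS** for `φ` continuous: the fibre `{c_g = r}` is clopen (★ `isClopen_setOf_borelHeight_mul_finAdelicToAdelic_div_eq`). [cite: Garrett2018, §2.2]
[cite: MoeglinWaldspurger1995, I.2.2] -/
theorem continuous_indicator_translate (g : ↥(finAdelic (↥(maximalRealSubfield L)) L (IsCMField.complexConj L) 3 ((StdForm.antidiagonal 3).over L))) (r : ℝ≥0) {φ : (quasiSplit (↥(maximalRealSubfield L)) L (IsCMField.complexConj L) 3).Adelic → ℂ} (hφc : Continuous φ) :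
    Continuous ({x : (quasiSplit (↥(maximalRealSubfield L)) L (IsCMField.complexConj L) 3).Adelic | borelHeight (x * finAdelicToAdelic (↥(maximalRealSubfield L)) L (IsCMField.complexConj L) 3 ((StdForm.antidiagonal 3).over L) g) / borelHeight x = r}.indicator fun y => φ (y * finAdelicToAdelic (↥(maximalRealSubfield L)) L (IsCMField.complexConj L) 3 ((StdForm.antidiagonal 3).over L) g)) :=
  (isClopen_setOf_borelHeight_mul_finAdelicToAdelic_div_eq g r).continuous_indicator (hφc.comp (continuous_mul_const _))

/-- **THE PIECE `ψ_r` IS `K_∞`-FINITE** for `φ` `K_∞`-finite: `ι(K_∞)` commutes with `ι_f g` (★ `commute_archToAdelic_finAdelicToAdelic`) and fixes `H` on the right (★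
`borelHeight_mul_of_mem_comap_standardMaximalCompactGL`), so `r(k)ψ_r = T(r(k)φ)` for the LINEAR map `T θ := 𝟙[c_g = r]·θ(· ι_f g)`, whence `span{r(k)ψ_r} ≤ T(span{r(k)φ})` is
finite-dimensional. [cite: BorelJacquet1979, §1.3, §4.1] [cite: MoeglinWaldspurger1995, I.2.17] -/
theorem isArchFinite_indicator_translate (g : ↥(finAdelic (↥(maximalRealSubfield L)) L (IsCMField.complexConj L) 3 ((StdForm.antidiagonal 3).over L))) (r : ℝ≥0) {φ : (quasiSplit (↥(maximalRealSubfield L)) L (IsCMField.complexConj L) 3).Adelic → ℂ} (hφa : IsArchFinite L φ) :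
    IsArchFinite L ({x : (quasiSplit (↥(maximalRealSubfield L)) L (IsCMField.complexConj L) 3).Adelic | borelHeight (x * finAdelicToAdelic (↥(maximalRealSubfield L)) L (IsCMField.complexConj L) 3 ((StdForm.antidiagonal 3).over L) g) / borelHeight x = r}.indicator fun y => φ (y * finAdelicToAdelic (↥(maximalRealSubfield L)) L (IsCMField.complexConj L) 3 ((StdForm.antidiagonal 3).over L) g)) := by
  rw [isArchFinite_iff] at hφa ⊢
  -- the linear cut-off-and-substitute map `T θ := 𝟙[c_g = r] · θ(· ι_f g)`
  let T : ((quasiSplit (↥(maximalRealSubfield L)) L (IsCMField.complexConj L) 3).Adelic → ℂ) →ₗ[ℂ] ((quasiSplit (↥(maximalRealSubfield L)) L (IsCMField.complexConj L) 3).Adelic → ℂ) :=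
    { toFun := fun θ => {x : (quasiSplit (↥(maximalRealSubfield L)) L (IsCMField.complexConj L) 3).Adelic | borelHeight (x * finAdelicToAdelic (↥(maximalRealSubfield L)) L (IsCMField.complexConj L) 3 ((StdForm.antidiagonal 3).over L) g) / borelHeight x = r}.indicator fun y => θ (y * finAdelicToAdelic (↥(maximalRealSubfield L)) L (IsCMField.complexConj L) 3 ((StdForm.antidiagonal 3).over L) g)
      map_add' := fun θ₁ θ₂ => by
        ext y
        simp only [Set.indicator_apply, Pi.add_apply]
        split_ifs <;> simp
      map_smul' := fun a θ => by
        ext y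
        simp only [Set.indicator_apply, Pi.smul_apply, smul_eq_mul, RingHom.id_apply]
        split_ifs <;> simp }
  have hT : ∀ θ : (quasiSplit (↥(maximalRealSubfield L)) L (IsCMField.complexConj L) 3).Adelic → ℂ, T θ = {x : (quasiSplit (↥(maximalRealSubfield L)) L (IsCMField.complexConj L) 3).Adelic | borelHeight (x * finAdelicToAdelic (↥(maximalRealSubfield L)) L (IsCMField.complexConj L) 3 ((StdForm.antidiagonal 3).over L) g) / borelHeight x = r}.indicator (fun y => θ (y * finAdelicToAdelic (↥(maximalRealSubfield L)) L (IsCMField.complexConj L) 3 ((StdForm.antidiagonal 3).over L) g)) := fun θ => rfl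
  have hle : archTranslateSpan L ({x : (quasiSplit (↥(maximalRealSubfield L)) L (IsCMField.complexConj L) 3).Adelic | borelHeight (x * finAdelicToAdelic (↥(maximalRealSubfield L)) L (IsCMField.complexConj L) 3 ((StdForm.antidiagonal 3).over L) g) / borelHeight x = r}.indicator fun y => φ (y * finAdelicToAdelic (↥(maximalRealSubfield L)) L (IsCMField.complexConj L) 3 ((StdForm.antidiagonal 3).over L) g)) ≤ (archTranslateSpan L φ).map T := by
    rw [archTranslateSpan_def, Submodule.span_le]
    rintro _ ⟨k, rfl⟩
    obtain ⟨hkK, a, ha⟩ := (mem_archMaximalCompact_iff L (k : (quasiSplit (↥(maximalRealSubfield L)) L (IsCMField.complexConj L) 3).Adelic)).1 k.2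
    have hk' : (k : (quasiSplit (↥(maximalRealSubfield L)) L (IsCMField.complexConj L) 3).Adelic) ∈ ((standardMaximalCompactGL 3 L).comap (adelicVal (↥(maximalRealSubfield L)) L (IsCMField.complexConj L) 3 ((StdForm.antidiagonal 3).over L)) : Subgroup (quasiSplit (↥(maximalRealSubfield L)) L (IsCMField.complexConj L) 3).Adelic) := Subgroup.mem_comap.2 hkK
    have heq : rightTranslation (quasiSplit (↥(maximalRealSubfield L)) L (IsCMField.complexConj L) 3) (k : (quasiSplit (↥(maximalRealSubfield L)) L (IsCMField.complexConj L) 3).Adelic) ({x : (quasiSplit (↥(maximalRealSubfield L)) L (IsCMField.complexConj L) 3).Adelic | borelHeight (x * finAdelicToAdelic (↥(maximalRealSubfield L)) L (IsCMField.complexConj L) 3 ((StdForm.antidiagonal 3).over L) g) / borelHeight x = r}.indicator fun y => φ (y * finAdelicToAdelic (↥(maximalRealSubfield L)) L (IsCMField.complexConj L) 3 ((StdForm.antidiagonal 3).over L) g)) =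
        T (rightTranslation (quasiSplit (↥(maximalRealSubfield L)) L (IsCMField.complexConj L) 3) (k : (quasiSplit (↥(maximalRealSubfield L)) L (IsCMField.complexConj L) 3).Adelic) φ) := by
      rw [hT]
      ext y
      have hcomm : y * (k : (quasiSplit (↥(maximalRealSubfield L)) L (IsCMField.complexConj L) 3).Adelic) * finAdelicToAdelic (↥(maximalRealSubfield L)) L (IsCMField.complexConj L) 3 ((StdForm.antidiagonal 3).over L) g = y * finAdelicToAdelic (↥(maximalRealSubfield L)) L (IsCMField.complexConj L) 3 ((StdForm.antidiagonal 3).over L) g * (k : (quasiSplit (↥(maximalRealSubfield L)) L (IsCMField.complexConj L) 3).Adelic) := by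
        rw [mul_assoc, ← ha, (commute_archToAdelic_finAdelicToAdelic (a := a) (b := g)).eq, ← mul_assoc]
      have hc : borelHeight (y * finAdelicToAdelic (↥(maximalRealSubfield L)) L (IsCMField.complexConj L) 3 ((StdForm.antidiagonal 3).over L) g * (k : (quasiSplit (↥(maximalRealSubfield L)) L (IsCMField.complexConj L) 3).Adelic)) / borelHeight (y * (k : (quasiSplit (↥(maximalRealSubfield L)) L (IsCMField.complexConj L) 3).Adelic)) = borelHeight (y * finAdelicToAdelic (↥(maximalRealSubfield L)) L (IsCMField.complexConj L) 3 ((StdForm.antidiagonal 3).over L) g) / borelHeight y := by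
        rw [borelHeight_mul_of_mem_comap_standardMaximalCompactGL hk' (y * finAdelicToAdelic (↥(maximalRealSubfield L)) L (IsCMField.complexConj L) 3 ((StdForm.antidiagonal 3).over L) g), borelHeight_mul_of_mem_comap_standardMaximalCompactGL hk' y]
      simp only [rightTranslation_apply, Set.indicator_apply, Set.mem_setOf_eq, hcomm, hc]
    dsimp only
    rw [heq]
    exact Submodule.mem_map_of_mem (rightTranslation_mem_archTranslateSpan L φ k)
  exact Submodule.finiteDimensional_of_le hle

/-! ## §3 The re-expansion `flat(φ, z)(x ι_f g) = Σ_r r^z · flat(ψ_r, z)(x)` -/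

/-- **THE FLAT RE-EXPANSION ALONG THE HEIGHT COCYCLE**: for any finset `s` containing every value of `c_g`, `flat(φ, z)(x·ι_f g) = Σ_{r ∈ s} r^z · flat(ψ_r, z)(x)` — only the piece
`r = c_g(x)` is alive at `x`, and there `φ(x ι_f g)·H(x ι_f g)^z = c_g(x)^z · φ(x ι_f g) · H(x)^z` since `H(x ι_f g) = c_g(x)·H(x)` with both factors `≥ 0` (★ `borelHeight_pos`,
`Complex.mul_cpow_ofReal_nonneg`).  This is ★ FILE B's `hdec` with `cᵢ := r`, `ψᵢ := ψ_r`. [cite: MoeglinWaldspurger1995, II.1.5] [cite: Garrett2018, §2.2] -/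
theorem flatSectionU_mul_finAdelicToAdelic_eq_sum (g : ↥(finAdelic (↥(maximalRealSubfield L)) L (IsCMField.complexConj L) 3 ((StdForm.antidiagonal 3).over L))) {s : Finset ℝ≥0} (hs : ∀ x : (quasiSplit (↥(maximalRealSubfield L)) L (IsCMField.complexConj L) 3).Adelic, borelHeight (x * finAdelicToAdelic (↥(maximalRealSubfield L)) L (IsCMField.complexConj L) 3 ((StdForm.antidiagonal 3).over L) g) / borelHeight x ∈ s)
    (φ : (quasiSplit (↥(maximalRealSubfield L)) L (IsCMField.complexConj L) 3).Adelic → ℂ) (z : ℂ) (x : (quasiSplit (↥(maximalRealSubfield L)) L (IsCMField.complexConj L) 3).Adelic) :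
    flatSectionU φ z (x * finAdelicToAdelic (↥(maximalRealSubfield L)) L (IsCMField.complexConj L) 3 ((StdForm.antidiagonal 3).over L) g) = ∑ r ∈ s, (((r : ℝ) : ℂ) ^ z) * flatSectionU ({x : (quasiSplit (↥(maximalRealSubfield L)) L (IsCMField.complexConj L) 3).Adelic | borelHeight (x * finAdelicToAdelic (↥(maximalRealSubfield L)) L (IsCMField.complexConj L) 3 ((StdForm.antidiagonal 3).over L) g) / borelHeight x = r}.indicator fun y => φ (y * finAdelicToAdelic (↥(maximalRealSubfield L)) L (IsCMField.complexConj L) 3 ((StdForm.antidiagonal 3).over L) g)) z x := by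
  rw [Finset.sum_eq_single_of_mem (borelHeight (x * finAdelicToAdelic (↥(maximalRealSubfield L)) L (IsCMField.complexConj L) 3 ((StdForm.antidiagonal 3).over L) g) / borelHeight x) (hs x) (fun r _ hne => by
    rw [flatSectionU_apply, Set.indicator_of_notMem (fun h => hne (Set.mem_setOf_eq ▸ h).symm), zero_mul, mul_zero])]
  have hmem : x ∈ {y : (quasiSplit (↥(maximalRealSubfield L)) L (IsCMField.complexConj L) 3).Adelic | borelHeight (y * finAdelicToAdelic (↥(maximalRealSubfield L)) L (IsCMField.complexConj L) 3 ((StdForm.antidiagonal 3).over L) g) / borelHeight y = borelHeight (x * finAdelicToAdelic (↥(maximalRealSubfield L)) L (IsCMField.complexConj L) 3 ((StdForm.antidiagonal 3).over L) g) / borelHeight x} := by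
    rw [Set.mem_setOf_eq]
  rw [flatSectionU_apply, flatSectionU_apply, Set.indicator_of_mem hmem]
  have hx : borelHeight x ≠ 0 := (borelHeight_pos x).ne'
  have hprod : (((borelHeight (x * finAdelicToAdelic (↥(maximalRealSubfield L)) L (IsCMField.complexConj L) 3 ((StdForm.antidiagonal 3).over L) g) / borelHeight x : ℝ≥0) : ℝ) : ℂ) ^ z * (((borelHeight x : ℝ≥0) : ℝ) : ℂ) ^ z =
      (((borelHeight (x * finAdelicToAdelic (↥(maximalRealSubfield L)) L (IsCMField.complexConj L) 3 ((StdForm.antidiagonal 3).over L) g) : ℝ≥0) : ℝ) : ℂ) ^ z := by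
    rw [← Complex.mul_cpow_ofReal_nonneg (NNReal.coe_nonneg _) (NNReal.coe_nonneg _), ← Complex.ofReal_mul, ← NNReal.coe_mul, div_mul_cancel₀ _ hx]
  rw [← hprod]
  ring

/-- **THE VALUE SET OF RECORD**: the EXACT range of `c_g` as a finset (★ `finite_range_borelHeight_mul_finAdelicToAdelic_div_cm_three`) — it contains every value, and each member is
attained, hence POSITIVE (heights are positive, ★ `borelHeight_pos`): ★ FILE B's `hc`. [cite: Garrett2018, §2.2] [cite: MoeglinWaldspurger1995, I.2.2] -/
theorem exists_finset_range_heightCocycle (g : ↥(finAdelic (↥(maximalRealSubfield L)) L (IsCMField.complexConj L) 3 ((StdForm.antidiagonal 3).over L))) :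
    ∃ s : Finset ℝ≥0, (∀ x : (quasiSplit (↥(maximalRealSubfield L)) L (IsCMField.complexConj L) 3).Adelic, borelHeight (x * finAdelicToAdelic (↥(maximalRealSubfield L)) L (IsCMField.complexConj L) 3 ((StdForm.antidiagonal 3).over L) g) / borelHeight x ∈ s) ∧ ∀ r ∈ s, 0 < r := by
  refine ⟨(finite_range_borelHeight_mul_finAdelicToAdelic_div_cm_three L g).toFinset, fun x => (Set.Finite.mem_toFinset _).2 ⟨x, rfl⟩, fun r hr => ?_⟩
  obtain ⟨x, rfl⟩ := (Set.Finite.mem_toFinset _).1 hr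
  exact div_pos (borelHeight_pos _) (borelHeight_pos _)

end Summit.HodgeConjecture.HodgeConjecture.R90.S8

end
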